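import Summits.ABC.IUTFork.Repair.CandInternal14
import Summits.ABC.IUTFork.Repair.CandInternal11
import Summits.ABC.IUTFork.Repair.ProfileHeightPins
import HarnessLib

/-!
# IUT REPAIR BRANCH (rung LADDER-ABC:A2.RP), class (i) INTERNAL, sub-cell B0, seat rp-d2 — `CandInternal2Height`: the HEIGHT-AXIS cells
# (abc-iut-w5-d133's `shellHSetting p h d`, operator `rhoH`, q-datum `qDatumH`: q-parameter of valuation `h`, frame inflation `d`, typed
# log-shell HONEST = `𝒪`) of the log-shell rows RP-I05 / I05c / I06 / I06b / I06c / I06d / I18 — and the SEPARATION they exhibit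

Proof-only file (D-0012; no definition, no `Prop` fact) of the abc-iut cell, IUT REPAIR branch (REPAIR-SPEC v0.4 §PROFILE axis «H(eight)»;
abc-iut-rp-d2's AVAILABLE offer (a) 08:15Z). TAKES NO SIDE on [IUTchIII] Cor. 3.12 or on any author; candidates stay hypotheses; typed ≠
proved; standard axioms. Beds consumed BY NAME: abc-iut-w5-d133's `Repair.ProfileHeight`/`ProfileHeightPins` (p429379/p429694).

THE POINT OF THIS AXIS. On the one-ρ log-shell family (`CandInternal2Tests`) and the fat family (`CandInternal2Fat`) the inflation `d` sits
IN THE TYPED LOG-SHELL read by `shellSat`; on the height family it sits in the FRAME/GLUE only, while `MRData.shellPk = 𝒪` stays honest. So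
here the log-shell orbit `ρ(Ψ·𝓘)` is `B_{h·j²}` whatever `d` is (`orbitRegion_shellSat_PsiH`), and: RP-I05 ✓ for all `(h, d)`; RP-I05c ✓ iff
`d = 0`; **RP-I06 / I06b / I06c / I18 ✗ for every `h ≥ 1` and every `d`** (the honest shell never carries `q^{j²}` to `q`); RP-I06d ⟺ `4h ≤ d`.
SEPARATION (`height_separation`): at `3h ≤ d` the Licence, `GapH3` and (for `3h ≤ 2d`) the Statement HOLD (w5-d133 `shellH_licence_iff`,
`shellH_gapH3_iff`, `shellH_statement_iff`) while RP-I06 FAILS — so RP-I06 is NOT NECESSARY for the hull residual once the frame inflation is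
decoupled from the typed log-shell; the equivalence «GapH3 ≡ RP-I06⋆» of `CandInternal11Gap` is exactly as strong as its hypothesis RP-I05c
(the containers bound), which is what fails here (`h11_height_iff`). [claim: Mochizuki2012, status: disputed] [cite: ScholzeStix2018, §2.2 pp. 9–10]
-/

noncomputable section

open Set

namespace Summit.ABC.IUTFork.Repair.CandInternal2Height

open Thm311 Cor312 Cor312Vol Literature.IUT.LogThetaLattice Summit.ABC.IUTFork.Repair.CandInternal2
  Cor312.Checks Cor312.IdentifiedNonVacuity Cor312Vol.NaiveWitness Cor312Vol.PinnedWitness Cor312Vol.PinnedHonest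
  Summit.ABC.IUTFork.Repair.ProfileHeight GluedMonoids.Naive

variable (p : ℕ) (h : ℕ) (d : ℕ) [hp : Fact p.Prime]

/-! ## 1. The log-shell orbit on the height family: `B_{h·j²}`, independent of `d` -/

omit hp in
/-- Every column Kummer image of the splitting monoid is `Ψ^{(h)}` (sign-saturated). [folklore] -/
theorem naiveFullH_frobΨ (m : ℤ) :
    ((naiveFullH p h).toLatticeSituation.col (shellHSetting p h d).n).frobΨ m = fun v _ => PsiH p h v := by
  funext v hv
  exact image_PsiH_of_actsBySigns p h (twist_actsBySigns m) v

omit hp in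
/-- The action (i)(b) of the height family is coordinatewise multiplication (honest). [folklore] -/
theorem line_act_naiveH (n : ℤ) (vQ : toyIndex.VQ) (hv : vQ ∈ toyIndex.Vbad) (ψ ι : signShells.StarPacket vQ)
    (j : toyIndex.Label) (hj : j ≠ 0) :
    line j vQ ((((naiveFullH p h).toLatticeSituation.D n).act vQ hv ψ ι) ⟨j, hj⟩) =
      line j vQ (ψ ⟨j, hj⟩) * line j vQ (ι ⟨j, hj⟩) := by
  have e := map_smul (line j vQ) (line j vQ (ψ ⟨j, hj⟩)) (ι ⟨j, hj⟩ : signShells.Packet j vQ)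
  rw [smul_eq_mul] at e
  exact e

omit hp in
/-- `Ψ^{(h)} ⊆ Ψ^{(h)}·𝓘` (the honest shell `𝒪` contains `1`). [folklore] -/
theorem psiH_subset_shellSat (n : ℤ) (v : toyIndex.V) (hv : v ∈ toyIndex.Vbad) :
    PsiH p h v ⊆ shellSat (naiveFullH p h).toLatticeSituation n (fun v _ => PsiH p h v) v hv := fun ψ hψ => by
  refine ⟨ψ, hψ, fun j => (line j.1 (toyIndex.over v)).symm 1, fun j => ?_, funext fun j => ?_⟩
  · show line j.1 _ _ = 0 ∨ (0 : ℤ) ≤ padicValRat p (line j.1 _ _)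
    rw [LinearEquiv.apply_symm_apply, padicValRat.one]
    exact Or.inr le_rfl
  · apply (line j.1 (toyIndex.over v)).injective
    have e := map_smul (line j.1 (toyIndex.over v)) (line j.1 (toyIndex.over v) (ψ j))
      ((line j.1 (toyIndex.over v)).symm 1 : signShells.Packet j.1 (toyIndex.over v))
    rw [smul_eq_mul, LinearEquiv.apply_symm_apply, mul_one] at e
    exact e.symm

omit hp in
/-- The zero tuple lies in `Ψ^{(h)}·𝓘` (`ψ · 0 = 0`) — so the saturated datum is NOT Θ-type. [folklore] -/
theorem zero_mem_shellSat (n : ℤ) (v : toyIndex.V) (hv : v ∈ toyIndex.Vbad) :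
    (0 : signShells.StarPacket v) ∈ shellSat (naiveFullH p h).toLatticeSituation n (fun v _ => PsiH p h v) v hv :=
  ⟨expTuple p _ v, expTuple_mem p _ v, 0, fun j => Or.inl (by rw [Pi.zero_apply, map_zero]), by rw [map_zero]⟩

omit hp in
/-- `Ψ^{(h)}·𝓘` is not Θ-type (it contains `0`). [folklore] -/
theorem shellSat_not_thetaTypeH (n : ℤ) :
    shellSat (naiveFullH p h).toLatticeSituation n (fun v _ => PsiH p h v) ∉ thetaTypeH p h := fun hT =>
  (hT () (Set.mem_univ _) 0 (zero_mem_shellSat p h n () _)).1 (by rw [Pi.zero_apply, map_zero])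

omit hp in
/-- Hence `rhoH` reads the saturated datum holomorphically: `rhoH (Ψ·𝓘) = orbitRegion (Ψ·𝓘)`. [folklore] -/
theorem rhoH_shellSat (n : ℤ) (j : toyIndex.Label) (vQ : toyIndex.VQ) :
    rhoH p h d (shellSat (naiveFullH p h).toLatticeSituation n (fun v _ => PsiH p h v)) j vQ =
      orbitRegion p (shellSat (naiveFullH p h).toLatticeSituation n (fun v _ => PsiH p h v)) j vQ := by
  unfold rhoH; rw [if_neg (shellSat_not_thetaTypeH p h n)]

/-- **The log-shell orbit of the Θ-data on the height family is `B_{h·j²}` — for EVERY frame inflation `d`** (the typed shell is `𝒪`). [folklore] -/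
theorem orbitRegion_shellSat_PsiH (n : ℤ) (j : toyIndex.Label) (vQ : toyIndex.VQ) :
    orbitRegion p (shellSat (naiveFullH p h).toLatticeSituation n (fun v _ => PsiH p h v)) j vQ = pBall p j vQ ((h : ℤ) * jsq j) := by
  refine Set.Subset.antisymm ?_ ?_
  · by_cases hj : j = 0
    · subst hj
      rw [orbitRegion_zero, jsq_zero, mul_zero]
    · unfold orbitRegion
      rw [dif_neg hj]
      rintro x ⟨y, ⟨ψ, hψ, ι, hι, rfl⟩, u, hu, hx⟩
      rw [line_act_naiveH] at hx
      have hι' : line j vQ (ι ⟨j, hj⟩) = 0 ∨ (0 : ℤ) ≤ padicValRat p (line j vQ (ι ⟨j, hj⟩)) := hι ⟨j, hj⟩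
      have hu' : line j vQ u = 0 ∨ (0 : ℤ) ≤ padicValRat p (line j vQ u) := hu
      have hc := intg_mul p hι' hu'
      have he : ((h : ℤ) * jsq j) = ((h * (j : ℕ) ^ 2 : ℕ) : ℤ) := by unfold jsq; push_cast; ring
      rw [he]
      show line j vQ x = 0 ∨ (((h * (j : ℕ) ^ 2 : ℕ)) : ℤ) ≤ padicValRat p (line j vQ x)
      rcases hψ ⟨j, hj⟩ with h1 | h1
      · have h1' : line j vQ (ψ ⟨j, hj⟩) = (p : ℚ) ^ (h * (j : ℕ) ^ 2) := h1
        rw [hx, h1', mul_assoc, ← one_mul ((p : ℚ) ^ (h * (j : ℕ) ^ 2))]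
        exact (mem_pBall_pow_iff p (Or.inl rfl) _ _).2 hc
      · have h1' : line j vQ (ψ ⟨j, hj⟩) = -(p : ℚ) ^ (h * (j : ℕ) ^ 2) := h1
        rw [hx, h1', mul_assoc, neg_eq_neg_one_mul]
        exact (mem_pBall_pow_iff p (Or.inr rfl) _ _).2 hc
  · rw [← orbitRegion_PsiH p h j vQ]
    exact orbitRegion_mono p (fun v hv => psiH_subset_shellSat p h n v hv) j vQ

/-- The `rhoH`-region of every saturated column datum is `B_{h·j²}`. [folklore] -/
theorem rhoH_shellSat_frobΨ (m : ℤ) (j : toyIndex.Label) (vQ : toyIndex.VQ) :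
    rhoH p h d (shellSat (naiveFullH p h).toLatticeSituation (shellHSetting p h d).n
      (((naiveFullH p h).toLatticeSituation.col (shellHSetting p h d).n).frobΨ m)) j vQ = pBall p j vQ ((h : ℤ) * jsq j) := by
  rw [naiveFullH_frobΨ, rhoH_shellSat, orbitRegion_shellSat_PsiH]

/-- … so their union over `m` is `B_{h·j²}`. [folklore] -/
theorem iUnion_rhoH_shellSat (j : toyIndex.Label) (vQ : toyIndex.VQ) :
    (⋃ m : ℤ, rhoH p h d (shellSat (naiveFullH p h).toLatticeSituation (shellHSetting p h d).n
      (((naiveFullH p h).toLatticeSituation.col (shellHSetting p h d).n).frobΨ m)) j vQ) = pBall p j vQ ((h : ℤ) * jsq j) := by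
  have e : ∀ m : ℤ, rhoH p h d (shellSat (naiveFullH p h).toLatticeSituation (shellHSetting p h d).n
      (((naiveFullH p h).toLatticeSituation.col (shellHSetting p h d).n).frobΨ m)) j vQ = pBall p j vQ ((h : ℤ) * jsq j) :=
    fun m => rhoH_shellSat_frobΨ p h d m j vQ
  rw [Set.iUnion_congr e]; exact Set.iUnion_const _

/-! ## 2. The cells -/

/-- **H cell, RP-I05: HOLDS for every `(h, d)`** (`B_{h·j²} ⊆ B_{h·j²−d}`). [folklore] -/
theorem hInd3Hull_height : HInd3Hull (naiveFullH p h).toLatticeSituation (shellHSetting p h d) (rhoH p h d) := by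
  intro m j vQ
  rw [rhoH_shellSat_frobΨ, (shellH_thetaHull p h d j vQ).1, pBall_subset_iff]
  omega

/-- **H cell, RP-I05c (containers bound): HOLDS iff `d = 0`** (`B_{h·j²−d} ⊆ B_{h·j²}` iff `d ≤ 0`). [folklore] -/
theorem h11_height_iff : CandInternal11.H (naiveFullH p h).toLatticeSituation (shellHSetting p h d) (rhoH p h d) ↔ d = 0 := by
  constructor
  · intro hc
    have h2 := hc 0 ()
    rw [iUnion_rhoH_shellSat, (shellH_thetaHull p h d 0 ()).1, pBall_subset_iff] at h2
    rw [jsq_zero, mul_zero] at h2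
    omega
  · rintro rfl j vQ
    rw [iUnion_rhoH_shellSat, (shellH_thetaHull p h 0 j vQ).1, pBall_subset_iff]
    push_cast; omega

/-- **H cell, RP-I06: FAILS for every `h ≥ 1` and every `d`** (`B_h ⊄ B_{4h}` at `j = 2`: the HONEST shell never carries `q^{j²}` to `q`).
[folklore] -/
theorem not_hQShellOrbit_height (hh : 0 < h) :
    ¬ HQShellOrbit (naiveFullH p h).toLatticeSituation (shellHSetting p h d) (rhoH p h d) (qDatumH p h) := by
  intro hB
  have h2 := hB 2 ()
  have j2 : jsq (2 : toyIndex.Label) = 4 := by decide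
  rw [iUnion_rhoH_shellSat, rhoH_qDatumH p h d hh, orbitRegion_qDatumH p h (by decide), pBall_subset_iff, j2] at h2
  omega

/-- **H cell, RP-I06b: FAILS for `h ≥ 1`** (it would give RP-I06, `rhoH` being monotone on these data — directly: `(±p^h)_2 ∉ p^{4h}·𝒪`). [folklore] -/
theorem not_hQShellOrbitData_height (hh : 0 < h) :
    ¬ HQShellOrbitData (naiveFullH p h).toLatticeSituation (shellHSetting p h d) (qDatumH p h) := by
  rintro ⟨m, hm⟩
  have hq := hm () (Set.mem_univ _) (expTuple_mem p (fun _ => h) ())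
  rw [naiveFullH_frobΨ] at hq
  -- the label-2 component of an element of `Ψ·𝓘` has valuation ≥ 4h or vanishes
  have hx : orbitRegion p (shellSat (naiveFullH p h).toLatticeSituation (shellHSetting p h d).n (fun v _ => PsiH p h v)) 2 () ⊆
      pBall p 2 () ((h : ℤ) * jsq 2) := (orbitRegion_shellSat_PsiH p h _ 2 ()).le
  have hmem : (expTuple p (fun _ => h) ()) ⟨2, by decide⟩ ∈
      orbitRegion p (shellSat (naiveFullH p h).toLatticeSituation (shellHSetting p h d).n (fun v _ => PsiH p h v)) 2 () := by
    unfold orbitRegion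
    rw [dif_neg (by decide : (2 : toyIndex.Label) ≠ 0)]
    refine ⟨_, hq, (line 2 ()).symm 1, Or.inr (by rw [LinearEquiv.apply_symm_apply, padicValRat.one]), ?_⟩
    rw [LinearEquiv.apply_symm_apply, mul_one]
  have hv := hx hmem
  have hval : padicValRat p (line 2 () ((expTuple p (fun _ => h) ()) ⟨2, by decide⟩)) = h := by
    show padicValRat p (line 2 () ((line 2 ()).symm ((p : ℚ) ^ h))) = h
    rw [LinearEquiv.apply_symm_apply, padicValRat_pow_nat]
  have hne : line 2 () ((expTuple p (fun _ => h) ()) ⟨2, by decide⟩) ≠ 0 := by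
    show line 2 () ((line 2 ()).symm ((p : ℚ) ^ h)) ≠ 0
    rw [LinearEquiv.apply_symm_apply]; exact pow_ne_zero _ (Nat.cast_ne_zero.mpr hp.out.ne_zero)
  rcases hv with h0 | hle
  · exact hne h0
  · have j2 : jsq (2 : toyIndex.Label) = 4 := by decide
    rw [hval, j2] at hle
    omega

/-- **H cell, RP-I06c: FAILS for `h ≥ 1`** (the hull of `B_{h·j²}` is itself). [folklore] -/
theorem not_h5_height (hh : 0 < h) :
    ¬ CandInternal5.H (naiveFullH p h).toLatticeSituation (shellHSetting p h d) (rhoH p h d) (qDatumH p h) := by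
  intro h5
  have h2 := h5 2 ()
  rw [iUnion_rhoH_shellSat, rhoH_qDatumH p h d hh, orbitRegion_qDatumH p h (by decide)] at h2
  have hh2 : ((shellHSetting p h d).frame 2 ()).hull (pBall p 2 () ((h : ℤ) * jsq 2)) = pBall p 2 () ((h : ℤ) * jsq 2) :=
    pFrame_hull_pBall p 2 () _
  have j2 : jsq (2 : toyIndex.Label) = 4 := by decide
  rw [hh2, pBall_subset_iff, j2] at h2
  omega

/-- **H cell, RP-I18: FAILS for `h ≥ 1`** (it would give RP-I06b). [folklore] -/
theorem not_h14_height (hh : 0 < h) :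
    ¬ CandInternal14.H (naiveFullH p h).toLatticeSituation (shellHSetting p h d) (qDatumH p h) := fun h14 =>
  not_hQShellOrbitData_height p h d hh (CandInternal14.hQShellOrbitData_of_H _ _ _ h14)

/-- **H cell, RP-I06d q-side half: HOLDS** (`B_h ⊆ 𝒪`; `𝒪 ⊆ 𝒪` at the zero label). [folklore] -/
theorem hQInShell_height (hh : 0 < h) :
    CandInternal8.HQInShell (naiveFullH p h).toLatticeSituation (shellHSetting p h d) (rhoH p h d) (qDatumH p h) := by
  intro j vQ
  rw [rhoH_qDatumH p h d hh]
  show orbitRegion p (qDatumH p h) j vQ ⊆ pBall p j vQ 0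
  by_cases hj : j = 0
  · subst hj; rw [orbitRegion_zero]
  · rw [orbitRegion_qDatumH p h hj, pBall_subset_iff]; exact_mod_cast Nat.zero_le h

/-- **H cell, RP-I06d inflation half: HOLDS iff `4h ≤ d`** (`𝒪 ⊆ B_{h·j²−d}` at `j = 2`). [folklore] -/
theorem hShellInHull_height_iff :
    CandInternal8.HShellInHull (naiveFullH p h).toLatticeSituation (shellHSetting p h d) ↔ 4 * h ≤ d := by
  constructor
  · intro hS
    have h2 := hS 2 ()
    have e : ((naiveFullH p h).toLatticeSituation.D (shellHSetting p h d).n).shellPk 2 () = pBall p 2 () 0 := rfl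
    have j2 : jsq (2 : toyIndex.Label) = 4 := by decide
    rw [e, (shellH_thetaHull p h d 2 ()).1, pBall_subset_iff, j2] at h2
    omega
  · intro hd j vQ
    have e : ((naiveFullH p h).toLatticeSituation.D (shellHSetting p h d).n).shellPk j vQ = pBall p j vQ 0 := rfl
    rw [e, (shellH_thetaHull p h d j vQ).1, pBall_subset_iff]
    have hj4 : jsq j ≤ 4 := by
      unfold jsq
      have hi : ((j : toyIndex.Label) : ℕ) ≤ 2 := Nat.le_of_lt_succ j.isLt
      have : ((j : toyIndex.Label) : ℕ) ^ 2 ≤ 2 ^ 2 := Nat.pow_le_pow_left hi 2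
      exact_mod_cast this
    have h0 : 0 ≤ jsq j := by unfold jsq; positivity
    nlinarith

/-! ## 3. The separation -/

/-- **HEIGHT SEPARATION: at `3h ≤ d` (`h ≥ 1`) the Licence and `GapH3` HOLD, the three pins hold, RP-I05 holds — and RP-I06 / RP-I05c FAIL.**
So RP-I06 is not necessary for the hull residual when the inflation lives in the frame rather than in the typed log-shell; `GapH3 ≡ RP-I06⋆`
(`CandInternal11Gap.gapH3_iff_star`) is exactly as strong as the containers bound RP-I05c. [folklore] -/
theorem height_separation (hh : 0 < h) (hd : 3 * h ≤ d) :
    Thm311ToCor312.Licence (shellHSetting p h d) ∧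
      GapH3 (naiveFullH p h).toLatticeSituation (shellHSetting p h d) (rhoH p h d) (qDatumH p h) ∧
      PinnedRegions3 (naiveFullH p h).toLatticeSituation (shellHSetting p h d) (rhoH p h d) (qDatumH p h) ∧
      HInd3Hull (naiveFullH p h).toLatticeSituation (shellHSetting p h d) (rhoH p h d) ∧
      ¬ HQShellOrbit (naiveFullH p h).toLatticeSituation (shellHSetting p h d) (rhoH p h d) (qDatumH p h) ∧
      ¬ CandInternal11.H (naiveFullH p h).toLatticeSituation (shellHSetting p h d) (rhoH p h d) :=
  ⟨(shellH_licence_iff p h d).2 hd, (shellH_gapH3_iff p h d hh).2 hd, shellH_pinnedRegions3 p h d hh, hInd3Hull_height p h d,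
    not_hQShellOrbit_height p h d hh, fun hc => by have := (h11_height_iff p h d).1 hc; omega⟩

/-- **HEIGHT CELLS packaged** (`h ≥ 1`): I05 ✓; I05c ↔ d = 0; I06 ✗; I06b ✗; I06c ✗; I18 ✗; I06d-q ✓; I06d-inflation ↔ 4h ≤ d. [folklore] -/
theorem height_cells (hh : 0 < h) :
    HInd3Hull (naiveFullH p h).toLatticeSituation (shellHSetting p h d) (rhoH p h d) ∧
      (CandInternal11.H (naiveFullH p h).toLatticeSituation (shellHSetting p h d) (rhoH p h d) ↔ d = 0) ∧
      ¬ HQShellOrbit (naiveFullH p h).toLatticeSituation (shellHSetting p h d) (rhoH p h d) (qDatumH p h) ∧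
      ¬ HQShellOrbitData (naiveFullH p h).toLatticeSituation (shellHSetting p h d) (qDatumH p h) ∧
      ¬ CandInternal5.H (naiveFullH p h).toLatticeSituation (shellHSetting p h d) (rhoH p h d) (qDatumH p h) ∧
      ¬ CandInternal14.H (naiveFullH p h).toLatticeSituation (shellHSetting p h d) (qDatumH p h) ∧
      CandInternal8.HQInShell (naiveFullH p h).toLatticeSituation (shellHSetting p h d) (rhoH p h d) (qDatumH p h) ∧
      (CandInternal8.HShellInHull (naiveFullH p h).toLatticeSituation (shellHSetting p h d) ↔ 4 * h ≤ d) :=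
  ⟨hInd3Hull_height p h d, h11_height_iff p h d, not_hQShellOrbit_height p h d hh, not_hQShellOrbitData_height p h d hh,
    not_h5_height p h d hh, not_h14_height p h d hh, hQInShell_height p h d hh, hShellInHull_height_iff p h d⟩

end Summit.ABC.IUTFork.Repair.CandInternal2Height

end
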